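import Mathlib
import Summits.ValiantsHypothesis.ValiantsHypothesis.Theorems.RigidityForcesSymmetryRankRigidMinimalReprLaplaceFiveSeparatedCaptureLinesK1
import Summits.ValiantsHypothesis.ValiantsHypothesis.Theorems.RigidityForcesSymmetryRankRigidMinimalReprLaplaceFiveSeparatedCaptureTriangle

/-!
# ValiantsHypothesis / RigidityForcesSymmetry — crux `LaplaceOptimalFive` (stmt-ValiantsHypothesis-24813), young-shadow K1:
# **K1 ON `K₃ ⊔ K₂` FOR A TRIANGLE OF SHORT SPANS** (trivial triple intersection inside a 3-space, total dimension `≥ 6`)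

K1 consumer of ✓ `captureIneqSym_of_triangle` (the `(2,2,2)♭` triangle family of `CaptureIneqSym`) through the local bridge
✓ `sideSym_K32canon_of_captureAt` (`…K1Bridge.lean`), in the shape of ✓ `sideSym_K32canon_lines / _two_lines / _disjoint_pair(_four) /
_nested_line`: a side-symmetric split decomposition of `P₅` on `{01, 02, 12, 34}` whose three triangle short spans have trivial triple
intersection, span together a space of dimension `≤ 3` and have total dimension `≥ 6` has Laplace weight `≥ 5! = 120`.  The
hypotheses are slot-symmetric, so a single placement is stated.

* ★★ `sideSym_K32canon_triangle` — the theorem.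

Honest framing.  A SUB-CASE of K1 on `K₃ ⊔ K₂`; two-equal-plus-line, common line, K1 on `K₃ ⊔ K₂` in general, `CaptureIneqSym`,
S2′, `LaplaceOptimalFive` (OPEN · CONTESTED 72/120), `RankRigidMinimalRepr`, `VP ≠ VNP` are NOT proved.  No definitions, no `sorry`.
-/

set_option linter.dupNamespace false
set_option autoImplicit false

namespace Summit.ValiantsHypothesis.ValiantsHypothesis.Theorems.RigidityForcesSymmetryRankRigidMinimalRepr

namespace LaplaceFiveSeparatedCapture

open Finset LaplaceFiveSectorSplit

/-- ★★ **K1 ON `K₃ ⊔ K₂ = {01, 02, 12, 34}` FOR A TRIANGLE OF SHORT SPANS**: the three triangle short spans have trivial triple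
intersection, together span a space of dimension `≤ 3`, and have total dimension `≥ 6` (e.g. three planes of a 3-space of quadrics
pairwise meeting in independent lines) ⇒ Laplace weight `≥ 5! = 120`.  K1 consumer of ✓ `captureIneqSym_of_triangle` through
✓ `sideSym_K32canon_of_captureAt`; the hypothesis set is invariant under the slot permutations, so one placement covers all. [folklore] -/
theorem sideSym_K32canon_triangle {N : ℕ} (T : Finset (Fin N)) (S : Fin N → Finset (Fin 5))
    (u w : Fin N → (Fin 5 → Fin 5) → ℂ) (hdec : IsSplitDecomposition T S u w) (hsym : SideSymmetric T S u w)
    (hC : ∀ t ∈ T, S t = ({0, 1} : Finset (Fin 5)) ∨ S t = ({0, 2} : Finset (Fin 5)) ∨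
      S t = ({1, 2} : Finset (Fin 5)) ∨ S t = ({3, 4} : Finset (Fin 5)))
    (hX : Module.finrank ℂ ↥(shortSpan T S u 0 1 ⊔ shortSpan T S u 0 2 ⊔ shortSpan T S u 1 2) ≤ 3)
    (hbot : shortSpan T S u 0 1 ⊓ shortSpan T S u 0 2 ⊓ shortSpan T S u 1 2 = ⊥)
    (h6 : 6 ≤ Module.finrank ℂ (shortSpan T S u 0 1) + Module.finrank ℂ (shortSpan T S u 0 2)
      + Module.finrank ℂ (shortSpan T S u 1 2)) :
    Nat.factorial 5 ≤ laplaceWeight T S := by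
  refine sideSym_K32canon_of_captureAt T S u w hdec hsym hC fun hs01 hs02 hs12 W hWs hWd hWc => ?_
  have hXs : ∀ x ∈ shortSpan T S u 0 1 ⊔ shortSpan T S u 0 2 ⊔ shortSpan T S u 1 2, ∀ p q : Fin 5, x p q = x q p := by
    intro x hx p q
    obtain ⟨y, hy, z, hz, rfl⟩ := Submodule.mem_sup.mp hx
    obtain ⟨a, ha, b, hb, rfl⟩ := Submodule.mem_sup.mp hy
    simp only [Pi.add_apply, hs01 a ha p q, hs02 b hb p q, hs12 z hz p q]
  exact captureIneqSym_of_triangle _ _ _ W _ hXs (le_sup_left.trans le_sup_left) (le_sup_right.trans le_sup_left) le_sup_right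
    hX hbot h6 hWs hWd hWc

end LaplaceFiveSeparatedCapture

end Summit.ValiantsHypothesis.ValiantsHypothesis.Theorems.RigidityForcesSymmetryRankRigidMinimalRepr
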